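import Mathlib.Topology.Algebra.Monoid
import Summits.AtomisticToContinuum.Crystallization.Theorems.FreeSplittingCertificatesStrictSplittingRuleP1Decision

/-!
# `StrictSplittingRule` (stmt-AtomisticToContinuum-12560): the P1 INTERPOLANT of a lattice field in chart coordinates (P1 interpolant object, part 5)

Route `FreeSplittingCertificates`, crux r3 `StrictSplittingRule` (H12⋆ = `stub_coreJointCoercive`), unit b2b-freesplit-B gen 20.
VALUE = fifth brick of item (2) of HOME FAR-LEMMA-SPEC §15 (d) (the P1 INTERPOLANT OBJECT).  NOT a proof of H12⋆, NOT summit progress.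

For a lattice field `U : ℤ³ → E` (site labels `(k,i,j)` of `hcpSite`) the interpolant in chart coordinates is the locally finite sum of
closed-form hat functions `p1Interp U q = Σᶠ_n p1Hat (parity n) (q − n) • U n` (`p1Phi n` = the hat function of site `n`, even-layer sites
`k` even use the `s = +1` gauge).  Proved here, with no case analysis left (parts 3–4 did it):
* `continuous_p1Interp` — continuity (locally finite sum of continuous functions);
* `p1Interp_p1Vec` — interpolation: `p1Interp U n = U n`;
* `exists_p1Cell` — the translated reference pieces `p1Cell (n, π) = n + p1RefCell (parity n) π` cover `ℝ³`;
* `p1Interp_eq_sum` — **cellwise affinity**: on `p1Cell (n, π)` the interpolant is `Σ_{m<4} p1Bary (q − n) • U (n + p1VertOff m)`, the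
  affine interpolant of the four vertex values (so its chart gradient maps vertex differences to value differences);
* `p1Interp_eq_zero_of_far` — it vanishes at sup-distance `≥ 1` from the support.
Part 6 composes with the inverse chart `p1ChartInv` and discharges the hypotheses of `farPencil4_weighted_integral_le_of_cellwise`.
[folklore: P1 finite elements]
-/

noncomputable section

open Set Function

namespace Summit.AtomisticToContinuum.Crystallization.Theorems.StrictSplittingRuleBirth

variable {E : Type*} [NormedAddCommGroup E] [NormedSpace ℝ E]

/-! ## Hat functions of the sites -/

/-- Layer parity of a site label: `true` iff the layer index `n.1` is even. -/
def p1Par (n : ℤ × ℤ × ℤ) : Bool := decide (Even n.1)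

/-- The hat function of site `n` in chart coordinates. -/
def p1Phi (n : ℤ × ℤ × ℤ) (q : Fin 3 → ℝ) : ℝ := p1Hat (p1Par n) (q - p1Vec n)

/-- Continuity of the site hat functions. -/
theorem continuous_p1Phi (n : ℤ × ℤ × ℤ) : Continuous (p1Phi n) :=
  (continuous_p1Hat _).comp (continuous_id.sub continuous_const)

/-- The site hat function vanishes at sup-distance `≥ 1` from the site. -/
theorem p1Phi_eq_zero_of_norm {n : ℤ × ℤ × ℤ} {q : Fin 3 → ℝ} (h : 1 ≤ ‖q - p1Vec n‖) : p1Phi n q = 0 :=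
  p1Hat_eq_zero_of_norm h

/-- If the site hat function is nonzero, the point is at sup-distance `< 1` from the site. -/
theorem norm_lt_one_of_p1Phi_ne_zero {n : ℤ × ℤ × ℤ} {q : Fin 3 → ℝ} (h : p1Phi n q ≠ 0) : ‖q - p1Vec n‖ < 1 :=
  norm_lt_one_of_p1Hat_ne_zero h

/-- The hat function of site `n` is `1` at `n`. -/
theorem p1Phi_self (n : ℤ × ℤ × ℤ) : p1Phi n (p1Vec n) = 1 := by
  simp [p1Phi, p1Hat_zero]

/-- An integer point other than `n` is at sup-distance `≥ 1` from `n`. -/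
theorem one_le_norm_p1Vec_sub {n n' : ℤ × ℤ × ℤ} (h : n' ≠ n) : 1 ≤ ‖p1Vec n' - p1Vec n‖ := by
  have key : ∀ {z : ℤ}, z ≠ 0 → (1 : ℝ) ≤ |(z : ℝ)| := fun {z} hz => by
    rw [← Int.cast_abs]; exact_mod_cast Int.one_le_abs hz
  by_cases h1 : n'.1 = n.1
  · by_cases h2 : n'.2.1 = n.2.1
    · have h3 : n'.2.2 ≠ n.2.2 := fun h3 => h (Prod.ext h1 (Prod.ext h2 h3))
      refine le_trans ?_ (norm_le_pi_norm (p1Vec n' - p1Vec n) 2)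
      rw [Real.norm_eq_abs, Pi.sub_apply, p1Vec_two, p1Vec_two, ← Int.cast_sub]
      exact key (sub_ne_zero.2 h3)
    · refine le_trans ?_ (norm_le_pi_norm (p1Vec n' - p1Vec n) 1)
      rw [Real.norm_eq_abs, Pi.sub_apply, p1Vec_one, p1Vec_one, ← Int.cast_sub]
      exact key (sub_ne_zero.2 h2)
  · refine le_trans ?_ (norm_le_pi_norm (p1Vec n' - p1Vec n) 0)
    rw [Real.norm_eq_abs, Pi.sub_apply, p1Vec_zero, p1Vec_zero, ← Int.cast_sub]
    exact key (sub_ne_zero.2 h1)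

/-- The hat function of site `n'` vanishes at every other integer point. -/
theorem p1Phi_p1Vec_of_ne {n n' : ℤ × ℤ × ℤ} (h : n' ≠ n) : p1Phi n' (p1Vec n) = 0 := by
  refine p1Phi_eq_zero_of_norm ?_
  rw [← norm_neg, neg_sub]
  exact one_le_norm_p1Vec_sub h

/-- An integer within distance `< 3/2` of a real lies in a window of four integers around its floor. -/
theorem int_mem_Icc_of_abs_sub_lt {z : ℤ} {x : ℝ} (h : |(z : ℝ) - x| < 3 / 2) : z ∈ Icc (⌊x⌋ - 1) (⌊x⌋ + 2) := by
  have h1 := Int.floor_le x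
  have h2 := Int.lt_floor_add_one x
  rw [abs_lt] at h
  constructor
  · by_contra hc
    have : (z : ℝ) ≤ ⌊x⌋ - 2 := by exact_mod_cast (show z ≤ ⌊x⌋ - 2 by omega)
    linarith
  · by_contra hc
    have : (⌊x⌋ : ℝ) + 3 ≤ z := by exact_mod_cast (show ⌊x⌋ + 3 ≤ z by omega)
    linarith

/-- **Local finiteness** of the supports of the site hat functions. -/
theorem p1Phi_locallyFinite : LocallyFinite fun n : ℤ × ℤ × ℤ => support (p1Phi n) := by
  intro q
  refine ⟨Metric.ball q (1 / 2), Metric.ball_mem_nhds q (by norm_num), ?_⟩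
  have hbox : (Icc (⌊q 0⌋ - 1) (⌊q 0⌋ + 2) ×ˢ (Icc (⌊q 1⌋ - 1) (⌊q 1⌋ + 2) ×ˢ Icc (⌊q 2⌋ - 1) (⌊q 2⌋ + 2)) :
      Set (ℤ × ℤ × ℤ)).Finite :=
    (finite_Icc _ _).prod ((finite_Icc _ _).prod (finite_Icc _ _))
  refine hbox.subset ?_
  rintro n ⟨q', hq'supp, hq'ball⟩
  have hlt : ‖q' - p1Vec n‖ < 1 := norm_lt_one_of_p1Phi_ne_zero hq'supp
  have hd : ‖p1Vec n - q‖ < 3 / 2 := by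
    have hb : dist q' q < 1 / 2 := hq'ball
    rw [dist_eq_norm] at hb
    calc ‖p1Vec n - q‖ = ‖(q' - q) - (q' - p1Vec n)‖ := by congr 1; abel
      _ ≤ ‖q' - q‖ + ‖q' - p1Vec n‖ := norm_sub_le _ _
      _ < 3 / 2 := by linarith
  have hc : ∀ j, |(p1Vec n - q) j| < 3 / 2 := fun j =>
    lt_of_le_of_lt (by simpa using norm_le_pi_norm (p1Vec n - q) j) hd
  refine ⟨?_, ?_, ?_⟩
  · exact int_mem_Icc_of_abs_sub_lt (by simpa using hc 0)
  · exact int_mem_Icc_of_abs_sub_lt (by simpa using hc 1)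
  · exact int_mem_Icc_of_abs_sub_lt (by simpa using hc 2)

/-! ## The interpolant -/

/-- **The P1 interpolant in chart coordinates**: `Σᶠ_n φ_n(q) • U n`. -/
def p1Interp (U : ℤ × ℤ × ℤ → E) (q : Fin 3 → ℝ) : E := ∑ᶠ n, p1Phi n q • U n

/-- **Continuity** of the interpolant (locally finite sum of continuous functions). -/
theorem continuous_p1Interp (U : ℤ × ℤ × ℤ → E) : Continuous (p1Interp U) := by
  refine continuous_finsum (fun n => (continuous_p1Phi n).smul continuous_const) ?_
  exact p1Phi_locallyFinite.subset fun n => support_smul_subset_left _ _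

/-- **Interpolation**: the interpolant takes the value `U n` at the integer point `n`. -/
theorem p1Interp_p1Vec (U : ℤ × ℤ × ℤ → E) (n : ℤ × ℤ × ℤ) : p1Interp U (p1Vec n) = U n := by
  unfold p1Interp
  rw [finsum_eq_single (fun n' => p1Phi n' (p1Vec n) • U n') n]
  · rw [p1Phi_self, one_smul]
  · intro n' hn'
    rw [p1Phi_p1Vec_of_ne hn', zero_smul]

/-- **Vanishing away from the support**: if every site of the support is at sup-distance `≥ 1` from `q`, the interpolant vanishes at `q`. -/
theorem p1Interp_eq_zero_of_far (U : ℤ × ℤ × ℤ → E) {q : Fin 3 → ℝ} (h : ∀ n, U n ≠ 0 → 1 ≤ ‖q - p1Vec n‖) :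
    p1Interp U q = 0 := by
  unfold p1Interp
  have : (fun n => p1Phi n q • U n) = fun _ => 0 := by
    funext n
    by_cases hn : U n = 0
    · rw [hn, smul_zero]
    · rw [p1Phi_eq_zero_of_norm (h n hn), zero_smul]
  rw [this, finsum_zero]

/-! ## The cells in chart coordinates -/

/-- The cell `(n, π)`: the reference piece `π` (of the parity of `n`) translated to the cube with origin `n`. -/
def p1Cell (i : (ℤ × ℤ × ℤ) × Fin 6) : Set (Fin 3 → ℝ) := {q | q - p1Vec i.1 ∈ p1RefCell (p1Par i.1) i.2}

/-- Membership in a cell, unfolded. -/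
theorem mem_p1Cell {i : (ℤ × ℤ × ℤ) × Fin 6} {q : Fin 3 → ℝ} : q ∈ p1Cell i ↔ q - p1Vec i.1 ∈ p1RefCell (p1Par i.1) i.2 :=
  Iff.rfl

/-- The cells are closed. -/
theorem isClosed_p1Cell (i : (ℤ × ℤ × ℤ) × Fin 6) : IsClosed (p1Cell i) :=
  (isClosed_p1RefCell _ _).preimage (continuous_id.sub continuous_const)

/-- A cell lies in the unit cube with origin `n`: coordinatewise `n_j ≤ q_j ≤ n_j + 1`. -/
theorem p1Cell_subset_cube {i : (ℤ × ℤ × ℤ) × Fin 6} {q : Fin 3 → ℝ} (hq : q ∈ p1Cell i) (j : Fin 3) :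
    p1Vec i.1 j ≤ q j ∧ q j ≤ p1Vec i.1 j + 1 := by
  have h := p1RefCell_subset_cube hq j
  simp only [Pi.sub_apply] at h
  constructor <;> linarith [h.1, h.2]

/-- A cell lies in the slab of its cube: `n.1 ≤ q 0 ≤ n.1 + 1`. -/
theorem p1Cell_slab {i : (ℤ × ℤ × ℤ) × Fin 6} {q : Fin 3 → ℝ} (hq : q ∈ p1Cell i) :
    (i.1.1 : ℝ) ≤ q 0 ∧ q 0 ≤ i.1.1 + 1 := by
  simpa using p1Cell_subset_cube hq 0

/-- **Cover**: every point of `ℝ³` lies in some cell (cube origin = coordinatewise floor). -/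
theorem exists_p1Cell (q : Fin 3 → ℝ) : ∃ i, q ∈ p1Cell i := by
  set n : ℤ × ℤ × ℤ := (⌊q 0⌋, ⌊q 1⌋, ⌊q 2⌋) with hn
  have hp : ∀ j, 0 ≤ (q - p1Vec n) j ∧ (q - p1Vec n) j ≤ 1 := by
    have h0 := Int.floor_le (q 0); have h0' := Int.lt_floor_add_one (q 0)
    have h1 := Int.floor_le (q 1); have h1' := Int.lt_floor_add_one (q 1)
    have h2 := Int.floor_le (q 2); have h2' := Int.lt_floor_add_one (q 2)
    intro j
    fin_cases j <;>
      simp only [hn, Pi.sub_apply, p1Vec_zero, p1Vec_one, p1Vec_two, Fin.zero_eta, Fin.mk_one, Fin.reduceFinMk] <;>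
      constructor <;> linarith
  obtain ⟨π, hπ⟩ := exists_p1RefCell (p1Par n) hp
  exact ⟨(n, π), hπ⟩

/-! ## Cellwise affinity -/

/-- Parity of a corner site: for `c ∈ {0,1}³`, the layer parity of `n + c` is `p1CornerEven (p1Par n) c`. -/
theorem p1Par_add_corner (n c : ℤ × ℤ × ℤ) (hc : c.1 = 0 ∨ c.1 = 1) : p1Par (n + c) = p1CornerEven (p1Par n) c := by
  unfold p1Par p1CornerEven
  rcases hc with hc | hc
  · by_cases hn : Even n.1 <;> simp [hn, hc]
  · by_cases hn : Even n.1
    · have : ¬ Even (n.1 + 1) := fun h2 => Int.not_even_one ((Int.even_add.1 h2).1 hn)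
      simp [hn, hc, this]
    · have : Even (n.1 + 1) := Int.not_even_iff_odd.1 hn |>.add_one
      simp [hn, hc, this]

/-- A site whose hat function does not vanish on the cell `(n, π)` at `q` is a corner `n + c`, `c ∈ {0,1}³`, of the cube. -/
theorem exists_corner_of_p1Phi_ne_zero {i : (ℤ × ℤ × ℤ) × Fin 6} {q : Fin 3 → ℝ} (hq : q ∈ p1Cell i) {n' : ℤ × ℤ × ℤ}
    (h : p1Phi n' q ≠ 0) :
    ((n' - i.1).1 = 0 ∨ (n' - i.1).1 = 1) ∧ ((n' - i.1).2.1 = 0 ∨ (n' - i.1).2.1 = 1) ∧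
      ((n' - i.1).2.2 = 0 ∨ (n' - i.1).2.2 = 1) := by
  have hlt := norm_lt_one_of_p1Phi_ne_zero h
  have hcube := p1Cell_subset_cube hq
  have key : ∀ j, |(q - p1Vec n') j| < 1 := fun j =>
    lt_of_le_of_lt (by simpa using norm_le_pi_norm (q - p1Vec n') j) hlt
  have main : ∀ {z m : ℤ} {x : ℝ}, (m : ℝ) ≤ x → x ≤ m + 1 → |x - z| < 1 → z - m = 0 ∨ z - m = 1 := by
    intro z m x h1 h2 h3
    rw [abs_lt] at h3
    have h4 : (m : ℝ) - 1 < z := by linarith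
    have h5 : (z : ℝ) < m + 2 := by linarith
    have h6 : m - 1 < z := by exact_mod_cast h4
    have h7 : z < m + 2 := by exact_mod_cast h5
    omega
  refine ⟨?_, ?_, ?_⟩
  · exact main (hcube 0).1 (hcube 0).2 (by simpa using key 0)
  · exact main (hcube 1).1 (hcube 1).2 (by simpa using key 1)
  · exact main (hcube 2).1 (hcube 2).2 (by simpa using key 2)

/-- On the cell `(n, π)`, the hat function of the vertex `n + p1VertOff m` is the barycentric coordinate `m`. -/
theorem p1Phi_vert {i : (ℤ × ℤ × ℤ) × Fin 6} {q : Fin 3 → ℝ} (hq : q ∈ p1Cell i) (m : Fin 4) :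
    p1Phi (i.1 + p1VertOff (p1Par i.1) i.2 m) q = p1Bary (p1Par i.1) i.2 m (q - p1Vec i.1) := by
  have hpar : p1Par (i.1 + p1VertOff (p1Par i.1) i.2 m) = p1VertPar i.2 m := by
    rw [p1Par_add_corner _ _ (p1VertOff_mem _ _ _).1, ← p1VertPar_eq]
  rw [p1Phi, hpar, p1Vec_add, ← sub_sub]
  exact p1Hat_vert _ _ m hq

/-- On the cell `(n, π)`, the hat function of a listed non-vertex corner vanishes. -/
theorem p1Phi_nonvert {i : (ℤ × ℤ × ℤ) × Fin 6} {q : Fin 3 → ℝ} (hq : q ∈ p1Cell i) (m : Fin 4) :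
    p1Phi (i.1 + p1NonVertOff (p1Par i.1) i.2 m) q = 0 := by
  have hmem : (p1NonVertOff (p1Par i.1) i.2 m).1 = 0 ∨ (p1NonVertOff (p1Par i.1) i.2 m).1 = 1 := by
    generalize p1Par i.1 = e
    revert e m
    generalize i.2 = π
    revert π
    decide
  have hpar : p1Par (i.1 + p1NonVertOff (p1Par i.1) i.2 m) = p1NonVertPar i.2 m := by
    rw [p1Par_add_corner _ _ hmem, ← p1NonVertPar_eq]
  rw [p1Phi, hpar, p1Vec_add, ← sub_sub]
  exact p1Hat_nonvert _ _ m hq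

/-- On the cell `(n, π)`, only the four vertices have nonvanishing hat functions. -/
theorem exists_vert_of_p1Phi_ne_zero {i : (ℤ × ℤ × ℤ) × Fin 6} {q : Fin 3 → ℝ} (hq : q ∈ p1Cell i) {n' : ℤ × ℤ × ℤ}
    (h : p1Phi n' q ≠ 0) : ∃ m, n' = i.1 + p1VertOff (p1Par i.1) i.2 m := by
  obtain ⟨h0, h1, h2⟩ := exists_corner_of_p1Phi_ne_zero hq h
  rcases p1Corner_cases (p1Par i.1) i.2 (n' - i.1) h0 h1 h2 with ⟨m, hm⟩ | ⟨m, hm⟩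
  · exact ⟨m, by rw [← hm]; abel⟩
  · exfalso
    have : n' = i.1 + p1NonVertOff (p1Par i.1) i.2 m := by rw [← hm]; abel
    rw [this] at h
    exact h (p1Phi_nonvert hq m)

/-- **Cellwise affinity**: on the cell `(n, π)` the interpolant is the affine interpolant of the four vertex values,
`p1Interp U q = Σ_m λ_m(q − n) • U (n + v_m)`. -/
theorem p1Interp_eq_sum (U : ℤ × ℤ × ℤ → E) {i : (ℤ × ℤ × ℤ) × Fin 6} {q : Fin 3 → ℝ} (hq : q ∈ p1Cell i) :
    p1Interp U q = ∑ m : Fin 4, p1Bary (p1Par i.1) i.2 m (q - p1Vec i.1) • U (i.1 + p1VertOff (p1Par i.1) i.2 m) := by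
  classical
  unfold p1Interp
  set S : Finset (ℤ × ℤ × ℤ) := Finset.univ.image fun m : Fin 4 => i.1 + p1VertOff (p1Par i.1) i.2 m with hS
  have hsupp : support (fun n' => p1Phi n' q • U n') ⊆ (S : Set (ℤ × ℤ × ℤ)) := by
    intro n' hn'
    have hne : p1Phi n' q ≠ 0 := fun h0 => hn' (by simp [h0])
    obtain ⟨m, rfl⟩ := exists_vert_of_p1Phi_ne_zero hq hne
    simp [hS]
  rw [finsum_eq_sum_of_support_subset _ hsupp, hS, Finset.sum_image]
  · refine Finset.sum_congr rfl fun m _ => ?_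
    rw [p1Phi_vert hq m]
  · intro m _ m' _ hmm
    exact p1VertOff_injective _ _ (add_left_cancel hmm)

/-- The vertices of a cell belong to it. -/
theorem p1Vec_vert_mem_p1Cell (i : (ℤ × ℤ × ℤ) × Fin 6) (m : Fin 4) :
    p1Vec (i.1 + p1VertOff (p1Par i.1) i.2 m) ∈ p1Cell i := by
  rw [mem_p1Cell, p1Vec_add, add_sub_cancel_left]
  exact p1Vec_vertOff_mem _ _ _

end Summit.AtomisticToContinuum.Crystallization.Theorems.StrictSplittingRuleBirth
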